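import Literature.Analysis.Complex.PQMonomials
import Literature.LinearAlgebra.Alternating.WedgeWordsSorted
import Mathlib.Tactic.Module
import HarnessLib

/-!
# The `(p,q)`-pieces of `Alt³_ℝ(E; ℂ)` for a threefold lattice frame (form-level twin of the
# Künneth bookkeeping of `H³(E_τ³)`)

Companion of `Literature/Barriers/HodgeConjecture/GeneralizedHodgeTrivialReasonsCupProducts.lean`
(the cup-product bookkeeping `transversal`, `mixedCup`, `dvClass`, `holCup` of the twenty Künneth
classes of `H³(E_τ³)` in an `H¹`-frame `e a i`) and of `Literature/Analysis/Complex/PQMonomials.lean`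
(`Λ^{p,q} = span {dz_P ∧ dz̄_Q}`). Here the SAME bookkeeping is carried out on constant alternating
forms: for a frame of real-linear complex-valued `1`-forms `ε a i : E →L[ℝ] ℂ` (`a : Fin 3`,
`i : Fin 2`; on `E_τ³ = ℂ³/(ℤ + τℤ)³` the lattice coordinate forms `dx_{2a+1}, dx_{2a+2}` of
Lange–Birkenhake (1992), §1.1.4) we define `transversalForm ε S = ε₀ ∧ ε₁ ∧ ε₂ ∧ 1`,
`mixedCupForm`, `dvForm ε σ a = ε a 0 + σ ε a 1`, `holForm ε σ = dw₀ ∧ dw₁ ∧ dw₂ ∧ 1`, and prove,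
for a complex frame `φ a = dz_a` (a complex dual pair `(φ, v)` on `E`, `ι = Fin 3`) ADAPTED to `ε`,
i.e. `dz_a = ε a 0 + σ₁ ε a 1` and `dz̄_a = ε a 0 + σ₂ ε a 1` with `σ₁ ≠ σ₂` (on `E_τ³`: `σ₁ = τ`,
`σ₂ = τ̄`, Lange–Birkenhake §1.1.5, `dv_a = dx_{2a+1} + τ dx_{2a+2}`):

* (in the continuation file `GeneralizedHodgeTrivialReasonsTorusTypes`) `typeSubmodule_three_zero_eq`:
  `Λ^{3,0} = ℂ · holForm ε (σ₁,σ₁,σ₁)` (`= ℂ dz₀ ∧ dz₁ ∧ dz₂`); `typeSubmodule_zero_three_eq`;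
  `typeSubmodule_two_one_eq`: `Λ^{2,1}` is spanned by the three `holForm` with exactly one entry
  `σ₂` and the six `mixedCupForm ε a k (dvForm ε σ₁ d)` (`= dz_a ∧ dz̄_a ∧ dz_d /(σ₂ - σ₁)` in factor
  order), and `typeSubmodule_one_two_eq` symmetrically

— verbatim the shape of the Hodge clauses of `exists_hodgeDecomposition_of_cupProducts`, with cup
products of classes replaced by wedge products of forms. This file provides the bookkeeping:
`wedgeThree` and its slot-linearity and alternation, `holForm_eq_sum` (twin of
`holCup_eq_prodClass`), `mixedCupForm_dvForm` (twin of `mixedCup_dvClass`) and the key identity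
`dz_a ∧ dz̄_a = (σ₂ - σ₁) ε a 0 ∧ ε a 1` (`wedgeThree_dvForm_dvForm_left/right`).

## References

* H. Lange, Ch. Birkenhake, *Complex Abelian Varieties* (1992), §1.1.4 Prop. 1.1.20, §1.1.5
  Thm. 1.1.21, Prop. 1.1.23 (held copy, PDF pp. 24–26). [LangeBirkenhake1992]
* A. Grothendieck, Topology 8 (1969), p. 300 (`E_τ × E_τ × E_τ`). [GrothendieckTopology1969]
-/

noncomputable section

open scoped ComplexConjugate
open Complex Function ContinuousAlternatingMap
open Literature.LinearAlgebra.Alternating Literature.Analysis.Complex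

namespace Literature.Barriers.HodgeConjecture

variable {E : Type*} [NormedAddCommGroup E] [NormedSpace ℂ E]

/-! ### Triple wedge products and the form-level Künneth bookkeeping -/

/-- The ordered triple wedge `x ∧ y ∧ z ∧ 1 ∈ Alt³_ℝ(E; ℂ)` of three constant `1`-forms (form-level
twin of `cupThree`). [cite: LangeBirkenhake1992, §1.1.4 Prop. 1.1.20] -/
def wedgeThree (x y z : E →L[ℝ] ℂ) : E [⋀^Fin 3]→L[ℝ] ℂ :=
  wedgeSeq (oneForm₀ E) 3 ![x, y, z]

/-- `wedgeThree` as the generic `wedgeSeq`. [folklore] -/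
theorem wedgeThree_eq (x y z : E →L[ℝ] ℂ) : wedgeThree x y z = wedgeSeq (oneForm₀ E) 3 ![x, y, z] := rfl

/-- `x ∧ x ∧ z = 0`. [folklore] -/
theorem wedgeThree_self_left (x z : E →L[ℝ] ℂ) : wedgeThree x x z = 0 :=
  wedgeSeq_eq_zero_of_eq _ _ (i := 0) (j := 1) (by decide) rfl

/-- `x ∧ y ∧ y = 0`. [folklore] -/
theorem wedgeThree_self_right (x y : E →L[ℝ] ℂ) : wedgeThree x y y = 0 :=
  wedgeSeq_eq_zero_of_eq _ _ (i := 1) (j := 2) (by decide) rfl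

/-- `y ∧ x ∧ z = -(x ∧ y ∧ z)`. [folklore] -/
theorem wedgeThree_swap_left (x y z : E →L[ℝ] ℂ) : wedgeThree y x z = -wedgeThree x y z := by
  have h := wedgeSeq_comp_swap (oneForm₀ E) (k := 3) ![x, y, z] (i := 0) (j := 1) (by decide)
  have hv : (![x, y, z] ∘ Equiv.swap (0 : Fin 3) 1) = ![y, x, z] := by
    funext i; fin_cases i <;> rfl
  rw [hv] at h
  exact h

/-- `x ∧ z ∧ y = -(x ∧ y ∧ z)`. [folklore] -/
theorem wedgeThree_swap_right (x y z : E →L[ℝ] ℂ) : wedgeThree x z y = -wedgeThree x y z := by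
  have h := wedgeSeq_comp_swap (oneForm₀ E) (k := 3) ![x, y, z] (i := 1) (j := 2) (by decide)
  have hv : (![x, y, z] ∘ Equiv.swap (1 : Fin 3) 2) = ![x, z, y] := by
    funext i; fin_cases i <;> rfl
  rw [hv] at h
  exact h

/-- `x ∧ y ∧ z ∧ 1` as nested `wedgeOne`. [folklore] -/
theorem wedgeThree_eq_wedgeOne (x y z : E →L[ℝ] ℂ) :
    wedgeThree x y z = wedgeOne x (wedgeOne y (wedgeOne z (oneForm₀ E))) := rfl

/-- Additivity in the first slot. [folklore] -/
theorem wedgeThree_add_left (x x' y z : E →L[ℝ] ℂ) :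
    wedgeThree (x + x') y z = wedgeThree x y z + wedgeThree x' y z := by
  simp only [wedgeThree_eq_wedgeOne, wedgeOne_add_left]

/-- Homogeneity in the first slot. [folklore] -/
theorem wedgeThree_smul_left (a : ℂ) (x y z : E →L[ℝ] ℂ) :
    wedgeThree (a • x) y z = a • wedgeThree x y z := by
  simp only [wedgeThree_eq_wedgeOne, wedgeOne_smul_left]

/-- Additivity in the middle slot. [folklore] -/
theorem wedgeThree_add_mid (x y y' z : E →L[ℝ] ℂ) :
    wedgeThree x (y + y') z = wedgeThree x y z + wedgeThree x y' z := by
  simp only [wedgeThree_eq_wedgeOne, wedgeOne_add_left, wedgeOne_add]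

/-- Homogeneity in the middle slot. [folklore] -/
theorem wedgeThree_smul_mid (a : ℂ) (x y z : E →L[ℝ] ℂ) :
    wedgeThree x (a • y) z = a • wedgeThree x y z := by
  simp only [wedgeThree_eq_wedgeOne, wedgeOne_smul_left, wedgeOne_smul]

/-- Additivity in the last slot. [folklore] -/
theorem wedgeThree_add_right (x y z z' : E →L[ℝ] ℂ) :
    wedgeThree x y (z + z') = wedgeThree x y z + wedgeThree x y z' := by
  simp only [wedgeThree_eq_wedgeOne, wedgeOne_add_left, wedgeOne_add]

/-- Homogeneity in the last slot. [folklore] -/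
theorem wedgeThree_smul_right (a : ℂ) (x y z : E →L[ℝ] ℂ) :
    wedgeThree x y (a • z) = a • wedgeThree x y z := by
  simp only [wedgeThree_eq_wedgeOne, wedgeOne_smul_left, wedgeOne_smul]

variable (ε : Fin 3 → Fin 2 → (E →L[ℝ] ℂ))

/-- **Transversal forms** `ε_{0,S 0} ∧ ε_{1,S 1} ∧ ε_{2,S 2} ∧ 1` (twin of `transversal`).
[cite: LangeBirkenhake1992, §1.1.4 Prop. 1.1.20] -/
def transversalForm (S : Fin 3 → Fin 2) : E [⋀^Fin 3]→L[ℝ] ℂ :=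
  wedgeThree (ε 0 (S 0)) (ε 1 (S 1)) (ε 2 (S 2))

/-- **Mixed forms**, factor-ordered: `x ∧ ε_{a,0} ∧ ε_{a,1}` if `k < a`, `ε_{a,0} ∧ ε_{a,1} ∧ x` else
(twin of `mixedCup`). [cite: LangeBirkenhake1992, §1.1.4 Prop. 1.1.20] -/
def mixedCupForm (a : Fin 3) (k : Fin 2) (x : E →L[ℝ] ℂ) : E [⋀^Fin 3]→L[ℝ] ℂ :=
  if (k : ℕ) < (a : ℕ) then wedgeThree x (ε a 0) (ε a 1) else wedgeThree (ε a 0) (ε a 1) x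

/-- `dw_a = ε_{a,0} + σ ε_{a,1}` (twin of `dvClass`; on `E_τ³`, `dv_a` for `σ = τ` and `dv̄_a` for
`σ = τ̄`). [cite: LangeBirkenhake1992, §1.1.5 (proof of Thm. 1.1.21)] -/
def dvForm (σ : ℂ) (a : Fin 3) : E →L[ℝ] ℂ := ε a 0 + σ • ε a 1

/-- `dw₀ ∧ dw₁ ∧ dw₂ ∧ 1` with `dw_a = ε_{a,0} + σ_a ε_{a,1}` (twin of `holCup`).
[cite: LangeBirkenhake1992, §1.1.5 Prop. 1.1.23] -/
def holForm (σ : Fin 3 → ℂ) : E [⋀^Fin 3]→L[ℝ] ℂ :=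
  wedgeThree (dvForm ε (σ 0) 0) (dvForm ε (σ 1) 1) (dvForm ε (σ 2) 2)

/-- **`∏_a (ε_{a,0} + σ_a ε_{a,1}) = Σ_S (∏_{S a = 1} σ_a) ε_S`** (twin of `holCup_eq_prodClass`).
[cite: LangeBirkenhake1992, §1.1.5 Prop. 1.1.23] -/
theorem holForm_eq_sum (σ : Fin 3 → ℂ) :
    holForm ε σ = ∑ S : Fin 3 → Fin 2, (∏ a, if S a = 1 then σ a else 1) • transversalForm ε S := by
  have h := wedgeSeq_sum_smul (𝕜 := ℝ) (oneForm₀ E) (k := 3)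
    (fun a (i : Fin 2) ↦ (if i = 1 then σ a else 1)) (fun a i ↦ ε a i)
  have hl : (fun a ↦ ∑ s : Fin 2, (if s = 1 then σ a else 1) • ε a s) =
      ![dvForm ε (σ 0) 0, dvForm ε (σ 1) 1, dvForm ε (σ 2) 2] := by
    funext a; fin_cases a <;> simp [Fin.sum_univ_two, dvForm]
  rw [hl] at h
  have hr : ∀ S : Fin 3 → Fin 2, wedgeSeq (oneForm₀ E) 3 (fun a ↦ ε a (S a)) = transversalForm ε S := by
    intro S
    have hS : (fun a ↦ ε a (S a)) = ![ε 0 (S 0), ε 1 (S 1), ε 2 (S 2)] := by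
      funext a; fin_cases a <;> rfl
    rw [hS]; rfl
  simp only [hr] at h
  exact h

/-- `ε_{a,0} ∧ ε_{a,1} ∧ dw_d = mixed 0 + σ • mixed 1`, factor-ordered (twin of `mixedCup_dvClass`).
[cite: LangeBirkenhake1992, §1.1.5 Prop. 1.1.23] -/
theorem mixedCupForm_dvForm (a : Fin 3) (k : Fin 2) (σ : ℂ) :
    mixedCupForm ε a k (dvForm ε σ (a.succAbove k)) =
      mixedCupForm ε a k (ε (a.succAbove k) 0) + σ • mixedCupForm ε a k (ε (a.succAbove k) 1) := by
  unfold mixedCupForm dvForm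
  split_ifs
  · rw [wedgeThree_add_left, wedgeThree_smul_left]
  · rw [wedgeThree_add_right, wedgeThree_smul_right]

/-- **`dw^{σ₁}_a ∧ dw^{σ₂}_a ∧ x = (σ₂ - σ₁) ε_{a,0} ∧ ε_{a,1} ∧ x`** (`ε ∧ ε = 0`, `ε₁ ∧ ε₀ = -ε₀ ∧ ε₁`);
on `E_τ³`: `dv_a ∧ dv̄_a = (τ̄ - τ) dx_{2a+1} ∧ dx_{2a+2}`. [cite: LangeBirkenhake1992, §1.1.5 Prop. 1.1.23] -/
theorem wedgeThree_dvForm_dvForm_left (σ₁ σ₂ : ℂ) (a : Fin 3) (x : E →L[ℝ] ℂ) :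
    wedgeThree (dvForm ε σ₁ a) (dvForm ε σ₂ a) x = (σ₂ - σ₁) • wedgeThree (ε a 0) (ε a 1) x := by
  simp only [dvForm, wedgeThree_add_left, wedgeThree_smul_left, wedgeThree_add_mid,
    wedgeThree_smul_mid, wedgeThree_self_left, wedgeThree_swap_left (ε a 0) (ε a 1)]
  module

/-- The same with the common factor on the right: `x ∧ dw^{σ₁}_a ∧ dw^{σ₂}_a = (σ₂ - σ₁) x ∧ ε_{a,0} ∧ ε_{a,1}`.
[cite: LangeBirkenhake1992, §1.1.5 Prop. 1.1.23] -/
theorem wedgeThree_dvForm_dvForm_right (σ₁ σ₂ : ℂ) (a : Fin 3) (x : E →L[ℝ] ℂ) :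
    wedgeThree x (dvForm ε σ₁ a) (dvForm ε σ₂ a) = (σ₂ - σ₁) • wedgeThree x (ε a 0) (ε a 1) := by
  simp only [dvForm, wedgeThree_add_mid, wedgeThree_smul_mid, wedgeThree_add_right,
    wedgeThree_smul_right, wedgeThree_self_right, wedgeThree_swap_right x (ε a 0) (ε a 1)]
  module

end Literature.Barriers.HodgeConjecture

end
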